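import Literature.Topology.FourManifolds.CollarNeck
import Literature.Topology.FourManifolds.NeckCapTransport
import HarnessLib

/-!
# Reconstruction data for a manifold cut along the necks adapted to the next surgery stage

Topological bookkeeping for the deduction of Hamilton's Cor. 1.2(a) from the Ricci flow with
surgery as vended structurally (`Literature.Geometry.Riemannian.IsSurgeryStep`,
`SurgicalRicciFlow.lean`; B.-L. Chen, X.-P. Zhu, J. Differential Geom. 74 (2006), Thm. 1.1
(i)–(iii)): a compact manifold `Q` (initially a component of `M_k`) is related to the next stage
`M'` (`= M_{k+1}`) by

* an open partial diffeomorphism `e : Q ⇀ M'` (the identification `Φ` of the common parts `N_k`),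
* finitely many **pieces** of `Q` off the domain where `e` is used — *tube pieces*
  `ι (𝕊ⁿ × (0,1))`, *ball pieces* `ι (B(0,1))`, and *matched ball pieces* (balls whose chart is
  already radially compatible with a chart of `M'` through `e`) — each coming with the chart(s)
  of the surgery ball(s) of `M'` at its boundary sphere(s), read through `e` as collars of those
  spheres *from the side of the common part* (`BallCollarData`, `CollarNeck.lean`),
* disjointness of the footprints of the pieces in `Q` and of the surgery balls in `M'`.

This file only sets up the structure (`GluePieces`, `SurgeryGlueData`), the derived sets
(pieces, the common part `N = Q ∖ ⋃ pieces`, footprints) and their elementary properties, and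
the **complexity** `3 · #tubes + #balls` which the cutting steps of the reconstruction
(`SurgeryGluePhases*.lean`) decrease. R. Hamilton, *Four-manifolds with positive isotropic
curvature*, Comm. Anal. Geom. 5 (1997), §1.1 pp. 3–4.

## References

* R. S. Hamilton, *Four-manifolds with positive isotropic curvature*, Comm. Anal. Geom. 5 (1997)
  1–92, §1.1 pp. 3–4. [Hamilton1997]
* B.-L. Chen, X.-P. Zhu, *Ricci flow with surgery on four-manifolds with positive isotropic
  curvature*, J. Differential Geom. 74 (2006), Thm. 1.1. [ChenZhu2006]
-/

open scoped Manifold ContDiff Topology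
open Set Function Metric Module Filter OpenPartialHomeomorph Topology

noncomputable section

namespace Literature.Topology.FourManifolds

open CollarProfile TubeProfile

/-! ### Shells and annuli of the model space -/

section Shell

variable {E : Type*} [NormedAddCommGroup E]

/-- The open shell `{1 - δ < ‖y‖ < 1 + ε}`. [folklore] -/
def shell (ε δ : ℝ) : Set E := {y | 1 - δ < ‖y‖ ∧ ‖y‖ < 1 + ε}

/-- The half-open outer annulus `{1 ≤ ‖y‖ < 1 + ε}`. [folklore] -/
def outerAnnulus (ε : ℝ) : Set E := {y | 1 ≤ ‖y‖ ∧ ‖y‖ < 1 + ε}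

/-- Membership in the shell. [folklore] -/
@[simp] theorem mem_shell {ε δ : ℝ} {y : E} : y ∈ shell ε δ ↔ 1 - δ < ‖y‖ ∧ ‖y‖ < 1 + ε := Iff.rfl

/-- Membership in the outer annulus. [folklore] -/
@[simp] theorem mem_outerAnnulus {ε : ℝ} {y : E} : y ∈ outerAnnulus ε ↔ 1 ≤ ‖y‖ ∧ ‖y‖ < 1 + ε := Iff.rfl

/-- The shell is open. [folklore] -/
theorem isOpen_shell (ε δ : ℝ) : IsOpen (shell ε δ : Set E) :=
  (isOpen_lt continuous_const continuous_norm).inter (isOpen_lt continuous_norm continuous_const)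

/-- The outer annulus lies in the shell (`δ > 0`). [folklore] -/
theorem outerAnnulus_subset_shell {ε δ : ℝ} (hδ : 0 < δ) : (outerAnnulus ε : Set E) ⊆ shell ε δ :=
  fun _ hy => ⟨by linarith [hy.1], hy.2⟩

/-- The unit sphere lies in the shell. [folklore] -/
theorem sphere_subset_shell {ε δ : ℝ} (hε : 0 < ε) (hδ : 0 < δ) : sphere (0 : E) 1 ⊆ shell ε δ := fun y hy => by
  rw [mem_sphere_zero_iff_norm] at hy
  exact ⟨by rw [hy]; linarith, by rw [hy]; linarith⟩

/-- The unit sphere lies in the outer annulus. [folklore] -/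
theorem sphere_subset_outerAnnulus {ε : ℝ} (hε : 0 < ε) : sphere (0 : E) 1 ⊆ outerAnnulus ε := fun y hy => by
  rw [mem_sphere_zero_iff_norm] at hy
  exact ⟨hy.ge, by rw [hy]; linarith⟩

/-- The shell lies in the closed ball of radius `1 + ε`. [folklore] -/
theorem shell_subset_closedBall (ε δ : ℝ) : (shell ε δ : Set E) ⊆ closedBall 0 (1 + ε) :=
  fun _ hy => mem_closedBall_zero_iff.2 hy.2.le

end Shell

section ShellConnected

variable {E : Type*} [NormedAddCommGroup E] [InnerProductSpace ℝ E] {n : ℕ} [Fact (finrank ℝ E = n + 1)]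

/-- The unit sphere is connected (`n ≠ 0`). [folklore] -/
theorem isConnected_unitSphere (hn : n ≠ 0) : IsConnected (sphere (0 : E) 1) := by
  haveI : FiniteDimensional ℝ E := .of_fact_finrank_eq_succ (K := ℝ) (V := E) n
  have h1 : 1 < Module.rank ℝ E := by
    rw [← Module.finrank_eq_rank, (Fact.out : finrank ℝ E = n + 1)]
    exact_mod_cast (by omega : 1 < n + 1)
  exact isConnected_sphere h1 (0 : E) zero_le_one

/-- **A radial shell `{a < ‖y‖ < b}` (`0 ≤ a < b`) is connected** for `n ≠ 0`: it is the image of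
`𝕊ⁿ × (a, b)` under `(θ, u) ↦ u • θ`. [folklore] -/
theorem isConnected_radialShell (hn : n ≠ 0) {a b : ℝ} (ha : 0 ≤ a) (hab : a < b) :
    IsConnected {y : E | a < ‖y‖ ∧ ‖y‖ < b} := by
  haveI := isConnected_iff_connectedSpace.1 (isConnected_unitSphere (E := E) hn)
  have h : {y : E | a < ‖y‖ ∧ ‖y‖ < b} = (fun q : sphere (0 : E) 1 × ℝ => q.2 • (q.1 : E)) '' (univ ×ˢ Ioo a b) := by
    apply Subset.antisymm
    · intro y hy
      have hy0 : y ≠ 0 := by rintro rfl; rw [mem_setOf_eq, norm_zero] at hy; linarith [hy.1]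
      exact ⟨(unitDir (unitSpherePoint n) y, ‖y‖), ⟨mem_univ _, hy⟩, norm_smul_coe_unitDir _ hy0⟩
    · rintro _ ⟨⟨θ, u⟩, ⟨-, hu⟩, rfl⟩
      have hu0 : 0 < u := ha.trans_lt hu.1
      rw [mem_setOf_eq, norm_smul, norm_eq_of_mem_sphere, mul_one, Real.norm_of_nonneg hu0.le]
      exact hu
  rw [h]
  exact (isConnected_univ.prod (isConnected_Ioo hab)).image _
    ((continuous_snd.smul (continuous_subtype_val.comp continuous_fst)).continuousOn)

/-- A radial half-open shell `{a ≤ ‖y‖ < b}` (`0 < a < b`) is connected for `n ≠ 0`. [folklore] -/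
theorem isConnected_radialShell' (hn : n ≠ 0) {a b : ℝ} (ha : 0 < a) (hab : a < b) :
    IsConnected {y : E | a ≤ ‖y‖ ∧ ‖y‖ < b} := by
  haveI := isConnected_iff_connectedSpace.1 (isConnected_unitSphere (E := E) hn)
  have h : {y : E | a ≤ ‖y‖ ∧ ‖y‖ < b} = (fun q : sphere (0 : E) 1 × ℝ => q.2 • (q.1 : E)) '' (univ ×ˢ Ico a b) := by
    apply Subset.antisymm
    · intro y hy
      have hy0 : y ≠ 0 := by rintro rfl; rw [mem_setOf_eq, norm_zero] at hy; linarith [hy.1]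
      exact ⟨(unitDir (unitSpherePoint n) y, ‖y‖), ⟨mem_univ _, hy⟩, norm_smul_coe_unitDir _ hy0⟩
    · rintro _ ⟨⟨θ, u⟩, ⟨-, hu⟩, rfl⟩
      have hu0 : 0 < u := ha.trans_le hu.1
      rw [mem_setOf_eq, norm_smul, norm_eq_of_mem_sphere, mul_one, Real.norm_of_nonneg hu0.le]
      exact hu
  rw [h]
  exact (isConnected_univ.prod (isConnected_Ico hab)).image _
    ((continuous_snd.smul (continuous_subtype_val.comp continuous_fst)).continuousOn)

/-- The shell `{1 - δ < ‖y‖ < 1 + ε}` is connected (`n ≠ 0`, `0 < ε`, `0 < δ ≤ 1`). [folklore] -/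
theorem isConnected_shell (hn : n ≠ 0) {ε δ : ℝ} (hε : 0 < ε) (hδ : 0 < δ) (hδ1 : δ ≤ 1) :
    IsConnected (shell ε δ : Set E) :=
  isConnected_radialShell hn (by linarith) (by linarith)

/-- The outer annulus `{1 ≤ ‖y‖ < 1 + ε}` is connected (`n ≠ 0`, `0 < ε`). [folklore] -/
theorem isConnected_outerAnnulus (hn : n ≠ 0) {ε : ℝ} (hε : 0 < ε) : IsConnected (outerAnnulus ε : Set E) :=
  isConnected_radialShell' hn one_pos (by linarith)

end ShellConnected


/-! ### A partial homeomorphism pulls back its own images -/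

section PH

variable {X Y : Type*} [TopologicalSpace X] [TopologicalSpace Y]

/-- `e⁻¹ (e s) = s` for `s ⊆ e.source` (the `PartialEquiv` lemma, restated for the coercions of
`OpenPartialHomeomorph`). [folklore] -/
theorem _root_.OpenPartialHomeomorph.symm_image_image_of_subset_source' (e : OpenPartialHomeomorph X Y) {s : Set X}
    (h : s ⊆ e.source) : e.symm '' (e '' s) = s :=
  e.toPartialEquiv.symm_image_image_of_subset_source h

end PH

/-! ### More on `inlSet` and transports (complements to `NeckCapTransport.lean`) -/

namespace NeckCapData

variable {E : Type*} [NormedAddCommGroup E] [InnerProductSpace ℝ E] {n : ℕ} [Fact (finrank ℝ E = n + 1)]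
  {P : Type*} [TopologicalSpace P] [ChartedSpace E P] {ψ : sphere (0 : E) 1 × ℝ → P} (D : NeckCapData n ψ)
  {M' : Type*} [TopologicalSpace M']

/-- `inlSet` commutes with unions. [folklore] -/
theorem inlSet_union (s t : Set P) : D.inlSet (s ∪ t) = D.inlSet s ∪ D.inlSet t := by
  apply Subset.antisymm
  · rintro _ ⟨a, (ha | ha), rfl⟩
    · exact Or.inl ⟨a, ha, rfl⟩
    · exact Or.inr ⟨a, ha, rfl⟩
  · rintro p (⟨a, ha, rfl⟩ | ⟨a, ha, rfl⟩)
    · exact ⟨a, Or.inl ha, rfl⟩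
    · exact ⟨a, Or.inr ha, rfl⟩

/-- `inlSet` commutes with indexed unions. [folklore] -/
theorem inlSet_iUnion {ι : Type*} (s : ι → Set P) : D.inlSet (⋃ i, s i) = ⋃ i, D.inlSet (s i) := by
  apply Subset.antisymm
  · rintro _ ⟨a, ha, rfl⟩
    obtain ⟨i, hi⟩ := mem_iUnion.1 ha
    exact mem_iUnion.2 ⟨i, a, hi, rfl⟩
  · intro p hp
    obtain ⟨i, a, ha, rfl⟩ := mem_iUnion.1 hp
    exact ⟨a, mem_iUnion.2 ⟨i, ha⟩, rfl⟩

/-- `inlSet` and differences. [folklore] -/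
theorem inlSet_diff_subset (s t : Set P) : D.inlSet s \ D.inlSet t ⊆ D.inlSet (s \ t) := by
  rintro _ ⟨⟨a, ha, rfl⟩, hb⟩
  exact ⟨a, ⟨ha, fun hat => hb (D.inl_mem_inlSet_iff.2 hat)⟩, rfl⟩

/-- `inlSet s` only depends on `s ∩ side`. [folklore] -/
theorem inlSet_inter_side (s : Set P) : D.inlSet (s ∩ (D.side : Set P)) = D.inlSet s := by
  apply Subset.antisymm
  · exact D.inlSet_mono inter_subset_left
  · rintro _ ⟨a, ha, rfl⟩; exact ⟨a, ⟨ha, a.2⟩, rfl⟩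

/-- A subset of the target of `e` whose pull-back lies in the side and the source lies in the
target of the transport. [folklore] -/
theorem subset_transport_target {e : OpenPartialHomeomorph P M'} {T : Set M'} (hT : T ⊆ e.target)
    (hT' : e.symm '' T ⊆ (D.side : Set P)) : T ⊆ (D.transport e).target := by
  rw [D.transport_target]
  intro y hy
  exact ⟨e.symm y, ⟨e.map_target (hT hy), hT' ⟨y, hy, rfl⟩⟩, e.right_inv (hT hy)⟩

/-- The image of an `inlSet` under the transport. [folklore] -/
theorem transport_image_inlSet_subset (e : OpenPartialHomeomorph P M') (s : Set P) : D.transport e '' D.inlSet s ⊆ e '' s := by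
  rintro _ ⟨_, ⟨a, ha, rfl⟩, rfl⟩
  exact ⟨a, ha, (D.transport_inl e a).symm⟩

/-- The image of an `inlSet` under the transport, exactly. [folklore] -/
theorem transport_image_inlSet (e : OpenPartialHomeomorph P M') (s : Set P) :
    D.transport e '' D.inlSet s = e '' (s ∩ (D.side : Set P)) := by
  apply Subset.antisymm
  · rintro _ ⟨_, ⟨a, ha, rfl⟩, rfl⟩
    exact ⟨a, ⟨ha, a.2⟩, (D.transport_inl e a).symm⟩
  · rintro _ ⟨p, ⟨hp, hps⟩, rfl⟩
    exact ⟨D.glueData.inl ⟨p, hps⟩, ⟨⟨p, hps⟩, hp, rfl⟩, D.transport_inl e ⟨p, hps⟩⟩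

/-- The image of a lifted image under the transport is the image under `e`. [folklore] -/
theorem transport_image_liftMap_image (e : OpenPartialHomeomorph P M') {X : Type*} (g : X → P)
    (hg : ∀ x, g x ∈ (D.side : Set P)) (s : Set X) : D.transport e '' (D.liftMap g hg '' s) = e '' (g '' s) := by
  rw [image_image, image_image]
  exact image_congr fun x _ => D.transport_inl e ⟨g x, hg x⟩

end NeckCapData

/-! ### The pieces -/

/-- The height of a tube end: `0` for `false`, `1` for `true`. [folklore] -/
def endHeight (b : Bool) : ℝ := bif b then 1 else 0

/-- The lower end has height `0`. [folklore] -/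
@[simp] theorem endHeight_false : endHeight false = 0 := rfl

/-- The upper end has height `1`. [folklore] -/
@[simp] theorem endHeight_true : endHeight true = 1 := rfl

/-- The half of the unit interval at a tube end: `(0, 1/2)` for `false`, `(1/2, 1)` for `true`.
[folklore] -/
def halfIoo (b : Bool) : Set ℝ := bif b then Ioo (1 / 2) 1 else Ioo 0 (1 / 2)

/-- The lower half. [folklore] -/
@[simp] theorem halfIoo_false : halfIoo false = Ioo 0 (1 / 2) := rfl

/-- The upper half. [folklore] -/
@[simp] theorem halfIoo_true : halfIoo true = Ioo (1 / 2) 1 := rfl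

/-- Both halves lie in `(0, 1)`. [folklore] -/
theorem halfIoo_subset (b : Bool) : halfIoo b ⊆ Ioo 0 1 := by
  cases b
  · exact fun t ht => ⟨ht.1, by linarith [ht.2]⟩
  · exact fun t ht => ⟨by linarith [ht.1], ht.2⟩

section Pieces

variable (E : Type*) [NormedAddCommGroup E] [InnerProductSpace ℝ E] (n : ℕ) [Fact (finrank ℝ E = n + 1)]
  (Q M' : Type*) [TopologicalSpace Q] [ChartedSpace E Q] [TopologicalSpace M'] [ChartedSpace E M']

/-- **The pieces of a reconstruction datum** (data and per-piece properties). An open partial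
diffeomorphism `e : Q ⇀ M'`; finitely many *tube pieces* `tube i : 𝕊ⁿ × ℝ ↪ Q` (piece
`tube i (𝕊ⁿ × (0,1))`) with, at each end `b`, the chart `tubeM i b : E ↪ M'` of a surgery ball
of `M'` and collar widths `tubeε i b`, `tubeδ i b`; finitely many *ball pieces* `ball j : E ↪ Q`
(piece `ball j (B(0,1))`) with their surgery-ball charts `ballM j` and widths; finitely many
*matched ball pieces* `mball k : E ↪ Q` with surgery-ball charts `mballM k` and a radial profile
`mprof k` (smooth, strictly increasing, positive derivative, positive at `1/4`). All charts are
smooth embeddings with open range. (Chen–Zhu 2006, Thm. 1.1 (iii): "`M_k ∖ N_k` consists of a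
finite number of disjoint pieces diffeomorphic to `S³ × 𝕀`, `𝔹⁴` …, while `M_{k+1} ∖ N_k` consists
of a finite number of disjoint pieces diffeomorphic to `𝔹⁴`".) [cite: ChenZhu2006, Thm. 1.1 (iii) (p. 3)] -/
structure GluePieces where
  /-- The identification of the common parts. -/
  e : OpenPartialHomeomorph Q M'
  /-- It is smooth on its source. -/
  contMDiffOn_e : ContMDiffOn 𝓘(ℝ, E) 𝓘(ℝ, E) ∞ e e.source
  /-- Its inverse is smooth on its target. -/
  contMDiffOn_e_symm : ContMDiffOn 𝓘(ℝ, E) 𝓘(ℝ, E) ∞ e.symm e.target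
  /-- Index type of the tube pieces. -/
  It : Type
  /-- Index type of the ball pieces. -/
  Ib : Type
  /-- Index type of the matched ball pieces. -/
  Im : Type
  [fintypeIt : Fintype It]
  [fintypeIb : Fintype Ib]
  [fintypeIm : Fintype Im]
  /-- The tube charts. -/
  tube : It → sphere (0 : E) 1 × ℝ → Q
  /-- The surgery-ball charts of `M'` at the two ends of the tubes. -/
  tubeM : It → Bool → E → M'
  /-- Outer collar widths at the tube ends. -/
  tubeε : It → Bool → ℝ
  /-- Inner collar widths at the tube ends. -/
  tubeδ : It → Bool → ℝ
  /-- The ball charts. -/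
  ball : Ib → E → Q
  /-- The surgery-ball charts of `M'` at the ball pieces. -/
  ballM : Ib → E → M'
  /-- Outer collar widths at the ball pieces. -/
  ballε : Ib → ℝ
  /-- Inner collar widths at the ball pieces. -/
  ballδ : Ib → ℝ
  /-- The matched ball charts. -/
  mball : Im → E → Q
  /-- The surgery-ball charts of `M'` matched to them. -/
  mballM : Im → E → M'
  /-- The matching radial profiles. -/
  mprof : Im → ℝ → ℝ
  isSmoothEmbedding_tube : ∀ i, Manifold.IsSmoothEmbedding ((𝓡 n).prod 𝓘(ℝ, ℝ)) 𝓘(ℝ, E) ∞ (tube i)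
  isOpen_range_tube : ∀ i, IsOpen (range (tube i))
  isSmoothEmbedding_tubeM : ∀ i b, Manifold.IsSmoothEmbedding 𝓘(ℝ, E) 𝓘(ℝ, E) ∞ (tubeM i b)
  isOpen_range_tubeM : ∀ i b, IsOpen (range (tubeM i b))
  isSmoothEmbedding_ball : ∀ j, Manifold.IsSmoothEmbedding 𝓘(ℝ, E) 𝓘(ℝ, E) ∞ (ball j)
  isOpen_range_ball : ∀ j, IsOpen (range (ball j))
  isSmoothEmbedding_ballM : ∀ j, Manifold.IsSmoothEmbedding 𝓘(ℝ, E) 𝓘(ℝ, E) ∞ (ballM j)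
  isOpen_range_ballM : ∀ j, IsOpen (range (ballM j))
  isSmoothEmbedding_mball : ∀ k, Manifold.IsSmoothEmbedding 𝓘(ℝ, E) 𝓘(ℝ, E) ∞ (mball k)
  isOpen_range_mball : ∀ k, IsOpen (range (mball k))
  isSmoothEmbedding_mballM : ∀ k, Manifold.IsSmoothEmbedding 𝓘(ℝ, E) 𝓘(ℝ, E) ∞ (mballM k)
  isOpen_range_mballM : ∀ k, IsOpen (range (mballM k))
  tubeε_pos : ∀ i b, 0 < tubeε i b
  tubeδ_pos : ∀ i b, 0 < tubeδ i b
  tubeδ_lt_one : ∀ i b, tubeδ i b < 1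
  ballε_pos : ∀ j, 0 < ballε j
  ballδ_pos : ∀ j, 0 < ballδ j
  ballδ_lt_one : ∀ j, ballδ j < 1
  contDiff_mprof : ∀ k, ContDiff ℝ ∞ (mprof k)
  strictMono_mprof : ∀ k, StrictMono (mprof k)
  deriv_mprof_pos : ∀ k s, 0 < deriv (mprof k) s
  mprof_pos : ∀ k s, 0 < s → 0 < mprof k s

attribute [instance] GluePieces.fintypeIt GluePieces.fintypeIb GluePieces.fintypeIm

namespace GluePieces

variable {E n Q M'}
variable (G : GluePieces E n Q M')

/-- The tube piece `tube i (𝕊ⁿ × (0,1))`. [folklore] -/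
def pieceT (i : G.It) : Set Q := G.tube i '' (univ ×ˢ Ioo 0 1)

/-- The ball piece `ball j (B(0,1))`. [folklore] -/
def pieceB (j : G.Ib) : Set Q := G.ball j '' Metric.ball 0 1

/-- The matched ball piece `mball k (B(0,1))`. [folklore] -/
def pieceM (k : G.Im) : Set Q := G.mball k '' Metric.ball 0 1

/-- The index type of all pieces. [folklore] -/
abbrev Idx : Type := G.It ⊕ (G.Ib ⊕ G.Im)

/-- The piece of an index. [folklore] -/
def piece : G.Idx → Set Q
  | Sum.inl i => G.pieceT i
  | Sum.inr (Sum.inl j) => G.pieceB j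
  | Sum.inr (Sum.inr k) => G.pieceM k

/-- The union of the pieces. [folklore] -/
def pieces : Set Q := ⋃ a, G.piece a

/-- **The common part** `N = Q ∖ ⋃ pieces`. [folklore] -/
def N : Set Q := G.piecesᶜ

/-- The end sphere `tube i (𝕊ⁿ × {h_b})` of a tube. [folklore] -/
def tubeSphere (i : G.It) (b : Bool) : Set Q := G.tube i '' (univ ×ˢ {endHeight b})

/-- The boundary sphere `ball j (𝕊)` of a ball piece. [folklore] -/
def ballSphere (j : G.Ib) : Set Q := G.ball j '' sphere 0 1

/-- **The footprint in `Q` of a tube piece**: the range of its chart together with the pulled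
back collar shells of its two surgery balls. [folklore] -/
def footT (i : G.It) : Set Q :=
  range (G.tube i) ∪ ⋃ b, G.e.symm '' (G.tubeM i b '' shell (G.tubeε i b) (G.tubeδ i b))

/-- **The footprint in `Q` of a ball piece**: the range of its chart together with the pulled
back collar shell of its surgery ball. [folklore] -/
def footB (j : G.Ib) : Set Q := range (G.ball j) ∪ G.e.symm '' (G.ballM j '' shell (G.ballε j) (G.ballδ j))

/-- **The footprint in `Q` of a matched ball piece**: the range of its chart. [folklore] -/
def footM (k : G.Im) : Set Q := range (G.mball k)

/-- The footprint in `Q` of an index. [folklore] -/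
def foot : G.Idx → Set Q
  | Sum.inl i => G.footT i
  | Sum.inr (Sum.inl j) => G.footB j
  | Sum.inr (Sum.inr k) => G.footM k

/-- The index type of the surgery balls of `M'` in the datum. [folklore] -/
abbrev IdxM : Type := (G.It × Bool) ⊕ (G.Ib ⊕ G.Im)

/-- **The footprint in `M'` of a surgery ball**: the closed ball of radius `1 + ε` of its chart
(tube ends, ball pieces), resp. of radius `h (1/2)` (matched balls). [folklore] -/
def footM' : G.IdxM → Set M'
  | Sum.inl ⟨i, b⟩ => G.tubeM i b '' closedBall 0 (1 + G.tubeε i b)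
  | Sum.inr (Sum.inl j) => G.ballM j '' closedBall 0 (1 + G.ballε j)
  | Sum.inr (Sum.inr k) => G.mballM k '' closedBall 0 (G.mprof k (1 / 2))

/-- **The complexity** `3 · #tubes + #balls`. [folklore] -/
def complexity : ℕ := 3 * Fintype.card G.It + Fintype.card G.Ib

/-! #### Elementary properties -/

/-- `piece_subset_pieces`: elementary bookkeeping (piece subset pieces). [folklore] -/
theorem piece_subset_pieces (a : G.Idx) : G.piece a ⊆ G.pieces := subset_iUnion _ a

/-- `pieceT_subset_pieces`: elementary bookkeeping (pieceT subset pieces). [folklore] -/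
theorem pieceT_subset_pieces (i : G.It) : G.pieceT i ⊆ G.pieces := G.piece_subset_pieces (Sum.inl i)

/-- `pieceB_subset_pieces`: elementary bookkeeping (pieceB subset pieces). [folklore] -/
theorem pieceB_subset_pieces (j : G.Ib) : G.pieceB j ⊆ G.pieces := G.piece_subset_pieces (Sum.inr (Sum.inl j))

/-- `pieceM_subset_pieces`: elementary bookkeeping (pieceM subset pieces). [folklore] -/
theorem pieceM_subset_pieces (k : G.Im) : G.pieceM k ⊆ G.pieces := G.piece_subset_pieces (Sum.inr (Sum.inr k))

/-- `mem_N_iff`: elementary bookkeeping (mem N iff). [folklore] -/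
theorem mem_N_iff {p : Q} : p ∈ G.N ↔ ∀ a, p ∉ G.piece a := by
  simp [N, pieces]

/-- `pieceT_subset_foot`: elementary bookkeeping (pieceT subset foot). [folklore] -/
theorem pieceT_subset_foot (i : G.It) : G.pieceT i ⊆ G.foot (Sum.inl i) := fun _ ⟨q, _, hq⟩ => Or.inl ⟨q, hq⟩

/-- `pieceB_subset_foot`: elementary bookkeeping (pieceB subset foot). [folklore] -/
theorem pieceB_subset_foot (j : G.Ib) : G.pieceB j ⊆ G.foot (Sum.inr (Sum.inl j)) := fun _ ⟨x, _, hx⟩ => Or.inl ⟨x, hx⟩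

/-- `pieceM_subset_foot`: elementary bookkeeping (pieceM subset foot). [folklore] -/
theorem pieceM_subset_foot (k : G.Im) : G.pieceM k ⊆ G.foot (Sum.inr (Sum.inr k)) := fun _ ⟨x, _, hx⟩ => ⟨x, hx⟩

/-- `piece_subset_foot`: elementary bookkeeping (piece subset foot). [folklore] -/
theorem piece_subset_foot (a : G.Idx) : G.piece a ⊆ G.foot a := by
  rcases a with i | j | k
  exacts [G.pieceT_subset_foot i, G.pieceB_subset_foot j, G.pieceM_subset_foot k]

/-- `range_tube_subset_foot`: elementary bookkeeping (range tube subset foot). [folklore] -/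
theorem range_tube_subset_foot (i : G.It) : range (G.tube i) ⊆ G.foot (Sum.inl i) := subset_union_left

/-- `range_ball_subset_foot`: elementary bookkeeping (range ball subset foot). [folklore] -/
theorem range_ball_subset_foot (j : G.Ib) : range (G.ball j) ⊆ G.foot (Sum.inr (Sum.inl j)) := subset_union_left

/-- `range_mball_subset_foot`: elementary bookkeeping (range mball subset foot). [folklore] -/
theorem range_mball_subset_foot (k : G.Im) : range (G.mball k) ⊆ G.foot (Sum.inr (Sum.inr k)) := Subset.rfl

/-- `injective_tube`: elementary bookkeeping (injective tube). [folklore] -/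
theorem injective_tube (i : G.It) : Injective (G.tube i) := (G.isSmoothEmbedding_tube i).isEmbedding.injective
/-- `injective_ball`: elementary bookkeeping (injective ball). [folklore] -/
theorem injective_ball (j : G.Ib) : Injective (G.ball j) := (G.isSmoothEmbedding_ball j).isEmbedding.injective
/-- `injective_mball`: elementary bookkeeping (injective mball). [folklore] -/
theorem injective_mball (k : G.Im) : Injective (G.mball k) := (G.isSmoothEmbedding_mball k).isEmbedding.injective
/-- `injective_tubeM`: elementary bookkeeping (injective tubeM). [folklore] -/
theorem injective_tubeM (i : G.It) (b : Bool) : Injective (G.tubeM i b) := (G.isSmoothEmbedding_tubeM i b).isEmbedding.injective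
/-- `injective_ballM`: elementary bookkeeping (injective ballM). [folklore] -/
theorem injective_ballM (j : G.Ib) : Injective (G.ballM j) := (G.isSmoothEmbedding_ballM j).isEmbedding.injective
/-- `injective_mballM`: elementary bookkeeping (injective mballM). [folklore] -/
theorem injective_mballM (k : G.Im) : Injective (G.mballM k) := (G.isSmoothEmbedding_mballM k).isEmbedding.injective

/-- `continuous_tube`: elementary bookkeeping (continuous tube). [folklore] -/
theorem continuous_tube (i : G.It) : Continuous (G.tube i) := (G.isSmoothEmbedding_tube i).contMDiff.continuous
/-- `continuous_ball`: elementary bookkeeping (continuous ball). [folklore] -/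
theorem continuous_ball (j : G.Ib) : Continuous (G.ball j) := (G.isSmoothEmbedding_ball j).contMDiff.continuous
/-- `continuous_mball`: elementary bookkeeping (continuous mball). [folklore] -/
theorem continuous_mball (k : G.Im) : Continuous (G.mball k) := (G.isSmoothEmbedding_mball k).contMDiff.continuous

/-- `isOpenEmbedding_tube`: elementary bookkeeping (isOpenEmbedding tube). [folklore] -/
theorem isOpenEmbedding_tube (i : G.It) : IsOpenEmbedding (G.tube i) :=
  ⟨(G.isSmoothEmbedding_tube i).isEmbedding, G.isOpen_range_tube i⟩
/-- `isOpenEmbedding_ball`: elementary bookkeeping (isOpenEmbedding ball). [folklore] -/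
theorem isOpenEmbedding_ball (j : G.Ib) : IsOpenEmbedding (G.ball j) :=
  ⟨(G.isSmoothEmbedding_ball j).isEmbedding, G.isOpen_range_ball j⟩
/-- `isOpenEmbedding_mball`: elementary bookkeeping (isOpenEmbedding mball). [folklore] -/
theorem isOpenEmbedding_mball (k : G.Im) : IsOpenEmbedding (G.mball k) :=
  ⟨(G.isSmoothEmbedding_mball k).isEmbedding, G.isOpen_range_mball k⟩
/-- `isOpenEmbedding_tubeM`: elementary bookkeeping (isOpenEmbedding tubeM). [folklore] -/
theorem isOpenEmbedding_tubeM (i : G.It) (b : Bool) : IsOpenEmbedding (G.tubeM i b) :=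
  ⟨(G.isSmoothEmbedding_tubeM i b).isEmbedding, G.isOpen_range_tubeM i b⟩
/-- `isOpenEmbedding_ballM`: elementary bookkeeping (isOpenEmbedding ballM). [folklore] -/
theorem isOpenEmbedding_ballM (j : G.Ib) : IsOpenEmbedding (G.ballM j) :=
  ⟨(G.isSmoothEmbedding_ballM j).isEmbedding, G.isOpen_range_ballM j⟩
/-- `isOpenEmbedding_mballM`: elementary bookkeeping (isOpenEmbedding mballM). [folklore] -/
theorem isOpenEmbedding_mballM (k : G.Im) : IsOpenEmbedding (G.mballM k) :=
  ⟨(G.isSmoothEmbedding_mballM k).isEmbedding, G.isOpen_range_mballM k⟩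

/-- The pieces are open. [folklore] -/
theorem isOpen_piece (a : G.Idx) : IsOpen (G.piece a) := by
  rcases a with i | j | k
  · exact (G.isOpenEmbedding_tube i).isOpenMap _ (isOpen_univ.prod isOpen_Ioo)
  · exact (G.isOpenEmbedding_ball j).isOpenMap _ isOpen_ball
  · exact (G.isOpenEmbedding_mball k).isOpenMap _ isOpen_ball

/-- The union of the pieces is open. [folklore] -/
theorem isOpen_pieces : IsOpen G.pieces := isOpen_iUnion G.isOpen_piece

/-- The common part is closed. [folklore] -/
theorem isClosed_N : IsClosed G.N := G.isOpen_pieces.isClosed_compl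

/-- `Q = N ∪ ⋃ pieces`. [folklore] -/
theorem N_union_pieces : G.N ∪ G.pieces = univ := compl_union_self _

/-- The pieces are connected (images of connected sets; `n ≠ 0`). [folklore] -/
theorem isConnected_piece (hn : n ≠ 0) (a : G.Idx) : IsConnected (G.piece a) := by
  haveI : FiniteDimensional ℝ E := .of_fact_finrank_eq_succ (K := ℝ) (V := E) n
  have h1 : 1 < Module.rank ℝ E := by
    rw [← Module.finrank_eq_rank, (Fact.out : finrank ℝ E = n + 1)]
    exact_mod_cast (by omega : 1 < n + 1)
  haveI : ConnectedSpace (sphere (0 : E) 1) := isConnected_iff_connectedSpace.1 (isConnected_sphere h1 (0 : E) zero_le_one)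
  have hball : IsConnected (Metric.ball (0 : E) 1) := (convex_ball (0 : E) 1).isConnected (by simp)
  rcases a with i | j | k
  · change IsConnected (G.tube i '' (univ ×ˢ Ioo 0 1))
    have h2 : IsConnected ((univ : Set (sphere (0 : E) 1)) ×ˢ Ioo (0 : ℝ) 1) :=
      isConnected_univ.prod (isConnected_Ioo (by norm_num : (0 : ℝ) < 1))
    exact h2.image _ (G.continuous_tube i).continuousOn
  · change IsConnected (G.ball j '' Metric.ball 0 1)
    exact hball.image _ (G.continuous_ball j).continuousOn
  · change IsConnected (G.mball k '' Metric.ball 0 1)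
    exact hball.image _ (G.continuous_mball k).continuousOn

end GluePieces

/-! ### Reconstruction data -/

/-- **Reconstruction datum of `Q` over `M'`** (`GluePieces` with the global compatibility
conditions): the common part `N` lies in the source of `e`; the footprints in `Q` of distinct
pieces are disjoint, as are the footprints in `M'` of distinct surgery balls; for each tube end
and each ball piece the surgery-ball chart of `M'`, read through `e⁻¹`, is a **collar of the
boundary sphere from the side of `N`**: its shell is in the target of `e`, its unit sphere is the
image of the boundary sphere, its open unit ball pulls back into the piece, and its outer
annulus pulls back into `N`; and each matched ball chart is **radially compatible** with its
surgery-ball chart through `e` off the centre, with the deep part of the surgery ball meeting the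
image of `e` only inside the image of the piece. (Chen–Zhu 2006, Thm. 1.1 (ii)–(iii): `N_k ⊆ M_k`
and `N_k ⊆ M_{k+1}` "isometric", the pieces of `M_{k+1} ∖ N_k` "diffeomorphic to `𝔹⁴`".)
[cite: ChenZhu2006, Thm. 1.1 (ii)–(iii) (p. 3)] -/
structure SurgeryGlueData where
  /-- The pieces. -/
  P : GluePieces E n Q M'
  /-- The common part lies in the source of `e`. -/
  N_subset_source : P.N ⊆ P.e.source
  /-- Footprints in `Q` of distinct pieces are disjoint. -/
  disjoint_foot : ∀ a a', a ≠ a' → Disjoint (P.foot a) (P.foot a')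
  /-- Footprints in `M'` of distinct surgery balls are disjoint. -/
  disjoint_footM' : ∀ c c', c ≠ c' → Disjoint (P.footM' c) (P.footM' c')
  /-- Tube ends: the collar shell is in the target of `e`. -/
  tubeM_shell : ∀ i b, P.tubeM i b '' shell (P.tubeε i b) (P.tubeδ i b) ⊆ P.e.target
  /-- Tube ends: the unit sphere of the surgery ball is the image of the end sphere. -/
  tubeM_sphere : ∀ i b, P.tubeM i b '' sphere 0 1 = P.e '' P.tubeSphere i b
  /-- Tube ends: the surgery ball pulls back into the adjacent half of the tube piece. -/
  tubeM_inner : ∀ i b, P.e.symm '' (P.tubeM i b '' Metric.ball 0 1 ∩ P.e.target) ⊆ P.tube i '' (univ ×ˢ halfIoo b)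
  /-- Tube ends: the outer annulus pulls back into the common part. -/
  tubeM_outer : ∀ i b, P.e.symm '' (P.tubeM i b '' outerAnnulus (P.tubeε i b)) ⊆ P.N
  /-- Ball pieces: the collar shell is in the target of `e`. -/
  ballM_shell : ∀ j, P.ballM j '' shell (P.ballε j) (P.ballδ j) ⊆ P.e.target
  /-- Ball pieces: the unit sphere of the surgery ball is the image of the boundary sphere. -/
  ballM_sphere : ∀ j, P.ballM j '' sphere 0 1 = P.e '' P.ballSphere j
  /-- Ball pieces: the surgery ball pulls back into the piece. -/
  ballM_inner : ∀ j, P.e.symm '' (P.ballM j '' Metric.ball 0 1 ∩ P.e.target) ⊆ P.pieceB j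
  /-- Ball pieces: the outer annulus pulls back into the common part. -/
  ballM_outer : ∀ j, P.e.symm '' (P.ballM j '' outerAnnulus (P.ballε j)) ⊆ P.N
  /-- Matched balls: radial compatibility `e (ι x) = ι' (h ‖x‖ • x/‖x‖)` off the centre. -/
  mball_match : ∀ k x, x ≠ 0 → P.mball k x ∈ P.e.source ∧ P.e (P.mball k x) = P.mballM k (radialMap (P.mprof k) x)
  /-- Matched balls: the deep part of the surgery ball meets `e (source)` only in `e (piece)`. -/
  mballM_deep : ∀ k, Disjoint (P.mballM k '' closedBall 0 (P.mprof k (1 / 2))) (P.e '' (P.e.source \ P.pieceM k))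

namespace SurgeryGlueData

variable {E n Q M'}
variable (G : SurgeryGlueData E n Q M')

/-- The complexity of a reconstruction datum. [folklore] -/
abbrev complexity : ℕ := G.P.complexity

/-! #### Consequences of the disjointness of footprints -/

/-- Distinct pieces are disjoint. [folklore] -/
theorem disjoint_piece {a a' : G.P.Idx} (h : a ≠ a') : Disjoint (G.P.piece a) (G.P.piece a') :=
  (G.disjoint_foot a a' h).mono (G.P.piece_subset_foot a) (G.P.piece_subset_foot a')

/-- A point of the footprint of `a` lying in a piece lies in the piece `a`. [folklore] -/
theorem eq_of_mem_foot_of_mem_piece {a a' : G.P.Idx} {p : Q} (hp : p ∈ G.P.foot a) (hp' : p ∈ G.P.piece a') : a = a' := by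
  by_contra h
  exact Set.disjoint_left.1 (G.disjoint_foot a a' h) hp (G.P.piece_subset_foot a' hp')

/-- A point of the footprint of `a` off the piece `a` lies in the common part. [folklore] -/
theorem mem_N_of_mem_foot {a : G.P.Idx} {p : Q} (hp : p ∈ G.P.foot a) (hpa : p ∉ G.P.piece a) : p ∈ G.P.N := by
  rw [GluePieces.mem_N_iff]
  intro a' ha'
  have := G.eq_of_mem_foot_of_mem_piece hp ha'
  subst this
  exact hpa ha'

/-- **The collar of a ball chart lies in the common part**: `ball j x ∈ N` for `‖x‖ ≥ 1`. [folklore] -/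
theorem ball_mem_N (j : G.P.Ib) {x : E} (hx : 1 ≤ ‖x‖) : G.P.ball j x ∈ G.P.N := by
  refine G.mem_N_of_mem_foot (G.P.range_ball_subset_foot j ⟨x, rfl⟩) ?_
  rintro ⟨y, hy, hyx⟩
  rw [G.P.injective_ball j hyx, mem_ball_zero_iff] at hy
  linarith

/-- The collar of a matched ball chart lies in the common part. [folklore] -/
theorem mball_mem_N (k : G.P.Im) {x : E} (hx : 1 ≤ ‖x‖) : G.P.mball k x ∈ G.P.N := by
  refine G.mem_N_of_mem_foot (G.P.range_mball_subset_foot k ⟨x, rfl⟩) ?_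
  rintro ⟨y, hy, hyx⟩
  rw [G.P.injective_mball k hyx, mem_ball_zero_iff] at hy
  linarith

/-- The collars of a tube chart lie in the common part: `tube i (θ, t) ∈ N` for `t ∉ (0,1)`. [folklore] -/
theorem tube_mem_N (i : G.P.It) (θ : sphere (0 : E) 1) {t : ℝ} (ht : t ∉ Ioo (0 : ℝ) 1) : G.P.tube i (θ, t) ∈ G.P.N := by
  refine G.mem_N_of_mem_foot (G.P.range_tube_subset_foot i ⟨(θ, t), rfl⟩) ?_
  rintro ⟨q, ⟨-, hq⟩, hqx⟩
  rw [G.P.injective_tube i hqx] at hq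
  exact ht hq

/-- The boundary sphere of a ball piece lies in the common part. [folklore] -/
theorem ballSphere_subset_N (j : G.P.Ib) : G.P.ballSphere j ⊆ G.P.N := by
  rintro _ ⟨x, hx, rfl⟩
  exact G.ball_mem_N j (mem_sphere_zero_iff_norm.1 hx).ge

/-- The end spheres of a tube lie in the common part. [folklore] -/
theorem tubeSphere_subset_N (i : G.P.It) (b : Bool) : G.P.tubeSphere i b ⊆ G.P.N := by
  rintro _ ⟨⟨θ, t⟩, ⟨-, ht⟩, rfl⟩
  rw [mem_singleton_iff] at ht
  subst ht
  refine G.tube_mem_N i θ ?_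
  cases b <;> simp [endHeight]

/-- The boundary sphere of a ball piece lies in the source of `e`. [folklore] -/
theorem ballSphere_subset_source (j : G.P.Ib) : G.P.ballSphere j ⊆ G.P.e.source :=
  (G.ballSphere_subset_N j).trans G.N_subset_source

/-- The end spheres of a tube lie in the source of `e`. [folklore] -/
theorem tubeSphere_subset_source (i : G.P.It) (b : Bool) : G.P.tubeSphere i b ⊆ G.P.e.source :=
  (G.tubeSphere_subset_N i b).trans G.N_subset_source

/-- A point off the source of `e` lies in some piece. [folklore] -/
theorem exists_mem_piece_of_not_mem_source {p : Q} (hp : p ∉ G.P.e.source) : ∃ a, p ∈ G.P.piece a := by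
  by_contra h
  push Not at h
  exact hp (G.N_subset_source ((GluePieces.mem_N_iff _).2 h))


/-! #### Connectedness of footprints -/

/-- A pulled-back collar shell is connected. [folklore] -/
theorem isConnected_symm_image_shell (hn : n ≠ 0) {g : E → M'} (hg : Continuous g) {ε δ : ℝ} (hε : 0 < ε) (hδ : 0 < δ)
    (hδ1 : δ ≤ 1) (hT : g '' shell ε δ ⊆ G.P.e.target) : IsConnected (G.P.e.symm '' (g '' shell ε δ)) :=
  ((isConnected_shell hn hε hδ hδ1).image g hg.continuousOn).image _ (G.P.e.continuousOn_symm.mono hT)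

/-- The pulled-back collar shell of a tube end contains the end sphere, which is in the range of
the tube. [folklore] -/
theorem tubeSphere_subset_symm_image_shell (i : G.P.It) (b : Bool) :
    G.P.tubeSphere i b ⊆ G.P.e.symm '' (G.P.tubeM i b '' shell (G.P.tubeε i b) (G.P.tubeδ i b)) := by
  have h : G.P.e.symm '' (G.P.tubeM i b '' sphere 0 1) = G.P.tubeSphere i b := by
    rw [G.tubeM_sphere i b]
    exact G.P.e.symm_image_image_of_subset_source' (G.tubeSphere_subset_source i b)
  rw [← h]
  exact image_mono (image_mono (sphere_subset_shell (G.P.tubeε_pos i b) (G.P.tubeδ_pos i b)))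

/-- The pulled-back collar shell of a ball piece contains the boundary sphere. [folklore] -/
theorem ballSphere_subset_symm_image_shell (j : G.P.Ib) :
    G.P.ballSphere j ⊆ G.P.e.symm '' (G.P.ballM j '' shell (G.P.ballε j) (G.P.ballδ j)) := by
  have h : G.P.e.symm '' (G.P.ballM j '' sphere 0 1) = G.P.ballSphere j := by
    rw [G.ballM_sphere j]
    exact G.P.e.symm_image_image_of_subset_source' (G.ballSphere_subset_source j)
  rw [← h]
  exact image_mono (image_mono (sphere_subset_shell (G.P.ballε_pos j) (G.P.ballδ_pos j)))

/-- The end spheres are nonempty. [folklore] -/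
theorem tubeSphere_nonempty (i : G.P.It) (b : Bool) : (G.P.tubeSphere i b).Nonempty :=
  ⟨_, ⟨(unitSpherePoint n, endHeight b), ⟨mem_univ _, rfl⟩, rfl⟩⟩

/-- The boundary spheres are nonempty. [folklore] -/
theorem ballSphere_nonempty (j : G.P.Ib) : (G.P.ballSphere j).Nonempty :=
  ⟨G.P.ball j ((unitSpherePoint n : sphere (0 : E) 1) : E), ⟨_, (unitSpherePoint n : sphere (0 : E) 1).2, rfl⟩⟩

/-- **Footprints are connected** (`n ≠ 0`): the range of the chart is connected and each pulled
back collar shell is connected and meets it in the corresponding sphere. [folklore] -/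
theorem isConnected_foot (hn : n ≠ 0) (a : G.P.Idx) : IsConnected (G.P.foot a) := by
  haveI := isConnected_iff_connectedSpace.1 (isConnected_unitSphere (E := E) hn)
  rcases a with i | j | k
  · change IsConnected (range (G.P.tube i) ∪ ⋃ b, G.P.e.symm '' (G.P.tubeM i b '' shell (G.P.tubeε i b) (G.P.tubeδ i b)))
    have hr : IsConnected (range (G.P.tube i)) := isConnected_range (G.P.continuous_tube i)
    have hS : ∀ b, IsConnected (G.P.e.symm '' (G.P.tubeM i b '' shell (G.P.tubeε i b) (G.P.tubeδ i b))) := fun b =>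
      G.isConnected_symm_image_shell hn (G.P.isSmoothEmbedding_tubeM i b).contMDiff.continuous (G.P.tubeε_pos i b)
        (G.P.tubeδ_pos i b) (G.P.tubeδ_lt_one i b).le (G.tubeM_shell i b)
    have hmeet : ∀ b, (range (G.P.tube i) ∩ G.P.e.symm '' (G.P.tubeM i b '' shell (G.P.tubeε i b) (G.P.tubeδ i b))).Nonempty := fun b => by
      obtain ⟨p, hp⟩ := G.tubeSphere_nonempty i b
      exact ⟨p, ⟨by obtain ⟨q, -, rfl⟩ := hp; exact mem_range_self q, G.tubeSphere_subset_symm_image_shell i b hp⟩⟩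
    have h1 := hr.union (hmeet false) (hS false)
    have hmeet' : ((range (G.P.tube i) ∪ G.P.e.symm '' (G.P.tubeM i false '' shell (G.P.tubeε i false) (G.P.tubeδ i false))) ∩
        G.P.e.symm '' (G.P.tubeM i true '' shell (G.P.tubeε i true) (G.P.tubeδ i true))).Nonempty := by
      obtain ⟨p, hp1, hp2⟩ := hmeet true
      exact ⟨p, Or.inl hp1, hp2⟩
    have h2 := h1.union hmeet' (hS true)
    convert h2 using 1
    ext p
    simp only [mem_union, mem_iUnion, Bool.exists_bool]
    tauto
  · change IsConnected (range (G.P.ball j) ∪ G.P.e.symm '' (G.P.ballM j '' shell (G.P.ballε j) (G.P.ballδ j)))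
    refine (isConnected_range (G.P.continuous_ball j)).union ?_
      (G.isConnected_symm_image_shell hn (G.P.isSmoothEmbedding_ballM j).contMDiff.continuous (G.P.ballε_pos j)
        (G.P.ballδ_pos j) (G.P.ballδ_lt_one j).le (G.ballM_shell j))
    obtain ⟨p, hp⟩ := G.ballSphere_nonempty j
    exact ⟨p, ⟨by obtain ⟨x, -, rfl⟩ := hp; exact mem_range_self x, G.ballSphere_subset_symm_image_shell j hp⟩⟩
  · exact isConnected_range (G.P.continuous_mball k)

/-- The pulled-back outer annulus of a tube end is connected and contains the end sphere. [folklore] -/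
theorem isConnected_symm_image_tubeM_outerAnnulus (hn : n ≠ 0) (i : G.P.It) (b : Bool) :
    IsConnected (G.P.e.symm '' (G.P.tubeM i b '' outerAnnulus (G.P.tubeε i b))) ∧
      G.P.tubeSphere i b ⊆ G.P.e.symm '' (G.P.tubeM i b '' outerAnnulus (G.P.tubeε i b)) := by
  have hT : G.P.tubeM i b '' outerAnnulus (G.P.tubeε i b) ⊆ G.P.e.target :=
    (image_mono (outerAnnulus_subset_shell (G.P.tubeδ_pos i b))).trans (G.tubeM_shell i b)
  refine ⟨((isConnected_outerAnnulus hn (G.P.tubeε_pos i b)).image _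
    (G.P.isSmoothEmbedding_tubeM i b).contMDiff.continuous.continuousOn).image _ (G.P.e.continuousOn_symm.mono hT), ?_⟩
  have h : G.P.e.symm '' (G.P.tubeM i b '' sphere 0 1) = G.P.tubeSphere i b := by
    rw [G.tubeM_sphere i b]
    exact G.P.e.symm_image_image_of_subset_source' (G.tubeSphere_subset_source i b)
  rw [← h]
  exact image_mono (image_mono (sphere_subset_outerAnnulus (G.P.tubeε_pos i b)))

end SurgeryGlueData

end Pieces

end Literature.Topology.FourManifolds

end
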